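/-
Copyright (c) 2026. All rights reserved.
Released under Apache 2.0 license as described in the file LICENSE.
Authors: abc-iut cell, statement-typer seat abc-iut-L4-t3 (wave 1).
-/
import Mathlib.CategoryTheory.Equivalence
import Literature.AnabelianGeometry.AbsoluteAnabelian.LogFrobeniusGraphs
import HarnessLib

/-!
# [AbsTopIII] Definition 5.4 (ii), (iv), (vi), (vii), Definition 5.6 (iii)–(iv), Proposition 5.8 (vii), and the diagram `D•⊢` of Corollaries 5.5 / 5.10

S. Mochizuki, *Topics in absolute anabelian geometry III: global reconstruction algorithms*,
J. Math. Sci. Univ. Tokyo 22 (2015) 939–1156 [MochizukiAbsTopIII2015]; locators `p.N` = pages of the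
author's manuscript (`paper:url-5493eb38cbb7`; journal pagination not held), read on the page: Def 5.4 (ii)
pp. 125–126, (iv) pp. 126–127, (vi) p. 128, (vii) p. 128; Cor 5.5 pp. 129–133; Rmk 5.5.1–5.5.2 p. 133; Def 5.6
(iii)–(iv) pp. 135–136; Prop 5.8 (vii) pp. 141–142; Cor 5.10 pp. 145–149; Rmk 5.10.1–5.10.4 pp. 149–162.

## What is typed and how

The "main result of the present §5 [and, indeed, of the present paper!]" (p. 145) is a statement about a
DIAGRAM OF CATEGORIES `D•` (Cor 5.5) and its mono-analytic extension `D•⊢` (Cor 5.10), with seven rows: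
row 1 = copies of `𝒳 := Th•_T[Z]` indexed by `L ≅ ℤ` joined by the log-Frobenius functor `log`, row 2 = one copy of
`𝒳` (the vertex `□`) receiving `id_⋎` from each copy, rows 3–4 = the categories `𝒩⊞_v → 𝒩_v` (`v ∈ V(F_mod)`)
receiving the functors `λ⊞_v = {λ⊞_{v,ν}}`, rows 5–7 = `ℰ• → An•[𝒳] → ℰ•` (the equivalences of Cor 5.2). We type:

* the INPUT DATA of Def 5.4 (ii), (iv), (vi), (vii), Cor 5.2, Def 5.6 (iii)–(iv), Prop 5.8 (vii) as ONE interface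
  structure `LogFrobeniusSetting` over Mathlib category theory: the categories `𝒳, ℰ•, An•[𝒳], 𝒩⊞_v, 𝒩_v` and
  their mono-analytic counterparts `ℰ⊢, An⊢[𝒩⊢⊞], 𝒩⊢⊞_w, 𝒩⊢_w`, the log-Frobenius functor `log•_{T,T}` with its
  natural isomorphism to the identity ("hence an equivalence") lying over `ℰ•`, the functors `λ⊞_{v,ν}` indexed by
  the vertices of `Γ⃗^log_v` (`LogFrobeniusGraphs.lean`), the natural transformations `ι⊞_{v,ε}`, the
  equivalences `κ_{An•}`, `φ_{An•}`, `π_{An•}`, `η_{An•}`, the mono-analyticization functors and the forgetful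
  functors `ψ^{An⊢⊞}_{w,ν}` — each field quoting its sentence (owners of the underlying categories: abc-iut-L4-t2
  for `C^{MLF}_T`, `C^{hol}_T`, Def 3.5; this seat for the theaters — TODO-merge);
* the SHAPE of `D•` as a concrete quiver `DVertex`/`DEdge` (rows 1–7) with the realization `DVertex.category`,
  and the sub-diagrams `D•_{≤n}`;
* NOT YET the assertions of Cor 5.5 (i)–(vi) and Cor 5.10 (iii), (iv)(a)–(c) themselves: they are statements about
  cores, telecores, contact structures, observables and nexus-classes of self-equivalences (Def 3.5, owner
  abc-iut-L4-t2, `DiagramsOfCategories.lean`) of the realised diagram `⟨DVertex, DEdge, DVertex.category,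
  DEdge.functor⟩`; they are typed in a follow-up file importing that vocabulary, so that each becomes a genuine
  statement rather than a predicate-valued placeholder. Only the combinatorial `ℤ`-action on the first row
  (`DVertex.shift`) underlying Cor 5.5 (v) is here;
* Rmk 5.5.1, 5.5.2, 5.6.1, 5.8.1 are expository (general formal content of Cor 3.6/3.7 remarks; no geometric
  panalocalization at closed points; "two combinatorial dimensions"; metric rigidity immune to
  mono-analyticization); they are RECORD NODES cited in docstrings only.

Cor 5.10 (i), (ii), (iv)(d) (finite log-volume of the log-shell, compatibility with `log`, mono-analytic log-shells)
have numerical content: typed in `LogShellVolumes.lean` over `LocalVolumes*.lean`, `LogShells.lean`.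
Refereed pre-IUT anabelian geometry; nothing here bears on [IUTchIII] Cor. 3.12; typed ≠ discharged.
-/

set_option autoImplicit false

universe u

open CategoryTheory

namespace Literature.AnabelianGeometry.AbsoluteAnabelian

/-- the vertex type of `Γ⃗^log_v`: archimedean or nonarchimedean according to `v`.
[cite: MochizukiAbsTopIII2015, Def 5.4 (iv) p. 127] -/
def LogVertex : Bool → Type
  | true => ArchVertex
  | false => NonarchVertex

/-- "is the post-log vertex" on `LogVertex b`. [cite: MochizukiAbsTopIII2015, Def 5.4 (vii) p. 128] -/
def LogVertex.isPostLog : {b : Bool} → LogVertex b → Bool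
  | true, ν => decide (ArchVertex.IsPostLog ν)
  | false, ν => decide (NonarchVertex.IsPostLog ν)

/-- "is the space-link vertex" on `LogVertex b`. [cite: MochizukiAbsTopIII2015, Def 5.4 (iv) p. 127] -/
def LogVertex.isSpaceLink : {b : Bool} → LogVertex b → Bool
  | true, ν => decide ((show ArchVertex from ν) = ArchVertex.spaceLink)
  | false, ν => decide ((show NonarchVertex from ν) = NonarchVertex.spaceLink)

/-- the vertices of `Γ⃗^×_v`: neither the post-log nor the space-link vertex (Def 5.4 (iv), (vi) treat "each vertex
`ν` of `Γ⃗^×_v`" and "the space-link or the post-log vertex of `Γ⃗^log_v`" as the two cases).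
[cite: MochizukiAbsTopIII2015, Def 5.4 (iv) p. 127] -/
def LogVertex.IsCross {b : Bool} (ν : LogVertex b) : Prop := ν.isPostLog = false ∧ ν.isSpaceLink = false

/-- the space-link vertex of `Γ⃗^log_v`. [cite: MochizukiAbsTopIII2015, Def 5.4 (iii) p. 126] -/
def LogVertex.spaceLink : (b : Bool) → LogVertex b
  | true => ArchVertex.spaceLink
  | false => NonarchVertex.spaceLink

/-- the post-log vertex of `Γ⃗^log_v`. [cite: MochizukiAbsTopIII2015, Def 5.4 (iii) p. 126] -/
def LogVertex.postLog : (b : Bool) → LogVertex b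
  | true => ArchVertex.postLog
  | false => NonarchVertex.postLog

/-- the edges of `Γ⃗^log_v` along which Def 5.4 (vii) provides `ι⊞_{v,ε}`: the edges of `Γ⃗^⋉_v` for `v`
nonarchimedean, all edges of `Γ⃗^log_v` for `v` archimedean. [cite: MochizukiAbsTopIII2015, Def 5.4 (vii) p. 128] -/
def LogEdge : (b : Bool) → LogVertex b → LogVertex b → Type
  | true, ν₁, ν₂ => ArchEdge ν₁ ν₂
  | false, ν₁, ν₂ => {e : NonarchEdge ν₁ ν₂ // e.InLeft}

/-! ## The setting: Def 5.4 (ii), (iv), (vi), (vii); Cor 5.2; Def 5.6 (iii), (iv); Prop 5.8 (vii) -/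

/-- INTERFACE. For fixed `Z` (elliptically admissible hyperbolic orbicurve over `ℚ̄`), `T ∈ {TF, TM}`, `• ∈ {⊚, ✠}`,
index set `V(F_mod)` with its archimedean/nonarchimedean partition (`isArc`): the categories and functors of the
global log-Frobenius picture. Fields quote print:
* `X` = `𝒳 := Th•_T[Z]`, `E` = `ℰ• := Th•[Z]`, `proj : 𝒳 → ℰ•` (Def 5.4 (i));
* `log` = "the global/panalocal log-Frobenius functor `log•_{T,T} : Th•_T → Th•_T`, which is naturally isomorphic
  to the identity functor, hence an equivalence of categories", "lies over `Th•`" (Def 5.4 (ii));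
* `Nplus v`, `N v`, `forget v : 𝒩⊞_v → 𝒩_v`, `toE v : 𝒩_v → ℰ•`, and `lam v ν = λ⊞_{v,ν} : Th•_T[Z] → 𝒩⊞_v` for each
  vertex `ν` of `Γ⃗^log_v`, the space-link and post-log functors being identified (Def 5.4 (iv), (vi));
* `iota v ε = ι⊞_{v,ε} : λ⊞_{v,ν₁} ∘ Λ_{ν₁} → λ⊞_{v,ν₂}` (Def 5.4 (vii));
* `An`, `κAn : ℰ• ≌ An•[𝒳]`, `φAn : An•[𝒳] → 𝒳` (an equivalence, the forgetful functor of Cor 5.2 (iv), (vii)),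
  `πAn := proj ⋙ κAn`, `ηAn : φAn ∘ πAn ≅ id_𝒳` (Cor 5.5 preamble);
* mono-analytic side: `Emono` = `ℰ⊢ := Th⊢[Z]`, `monoAn : ℰ• → ℰ⊢` (Def 5.6 (ii)), `NmonoPlus w`, `Nmono w`,
  `forgetMono`, `toEmono` (Def 5.6 (iii), (iv)), `monoN`, `monoNplus` (the vertical mono-analyticization functors
  of the 1-commutative diagrams of Def 5.6 (iii), (iv)), `AnMono` = `An⊢[𝒩⊢⊞] := ∏_v An⊢[𝒩⊢⊞_v]` with the
  equivalence `ℰ⊢ ≌ An⊢[𝒩⊢⊞]` and forgetful functors `ψ^{An⊢⊞}_{w,ν}` (Prop 5.8 (vii)).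
[cite: MochizukiAbsTopIII2015, Def 5.4 (ii) p. 125] -/
structure LogFrobeniusSetting (Vmod : Type u) (isArc : Vmod → Bool) : Type (u + 2) where
  /-- `𝒳 := Th•_T[Z]` -/
  X : Type (u + 1)
  /-- category structure -/
  [catX : Category.{u} X]
  /-- `ℰ• := Th•[Z]` -/
  E : Type (u + 1)
  /-- category structure -/
  [catE : Category.{u} E]
  /-- the natural projection `Th•_T[Z] → Th•[Z]` -/
  proj : X ⥤ E
  /-- the log-Frobenius functor `log•_{T,T}` -/
  log : X ⥤ X
  /-- "naturally isomorphic to the identity functor" -/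
  logIsoId : log ≅ 𝟭 X
  /-- "lies over `Th•`": the underlying Galois-theater is unchanged -/
  logOver : log ⋙ proj ≅ proj
  /-- `𝒩⊞_v` -/
  Nplus : Vmod → Type (u + 1)
  /-- category structure -/
  [catNplus : ∀ v, Category.{u} (Nplus v)]
  /-- `𝒩_v` -/
  N : Vmod → Type (u + 1)
  /-- category structure -/
  [catN : ∀ v, Category.{u} (N v)]
  /-- `𝒩⊞_v → 𝒩_v` -/
  forget : ∀ v, Nplus v ⥤ N v
  /-- `𝒩_v → Th•[Z]` -/
  toE : ∀ v, N v ⥤ E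
  /-- `λ⊞_{v,ν} : Th•_T[Z] → 𝒩⊞_v`, `ν` a vertex of `Γ⃗^log_v` -/
  lam : ∀ v, LogVertex (isArc v) → (X ⥤ Nplus v)
  /-- `λ⊞_{v,ν}` "lies over `Th•[Z]`" -/
  lamOver : ∀ v ν, lam v ν ⋙ forget v ⋙ toE v ≅ proj
  /-- "subject to the proviso that we identify the functors associated to the space-link and post-log vertices"
  (Cor 5.5 p. 130; both assign the underlying additive group of the field, Def 5.4 (iv), (vi)) -/
  lam_spaceLink_eq_postLog : ∀ v, lam v (LogVertex.spaceLink (isArc v)) = lam v (LogVertex.postLog (isArc v))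
  /-- `ι⊞_{v,ε} : λ⊞_{v,ν₁} ∘ Λ_{ν₁} → λ⊞_{v,ν₂}` for the admissible edges `ε : ν₁ → ν₂` -/
  iota : ∀ v {ν₁ ν₂ : LogVertex (isArc v)}, LogEdge (isArc v) ν₁ ν₂ →
    (frobeniusTwist log ν₁.isPostLog ⋙ lam v ν₁ ⟶ lam v ν₂)
  /-- `An•[𝒳]` -/
  An : Type (u + 1)
  /-- category structure -/
  [catAn : Category.{u} An]
  /-- `κ_{An•} : ℰ• ≃ An•[𝒳]` (Cor 5.2 (i), (iv), (vii), restricted to `[Z]`) -/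
  κAn : E ≌ An
  /-- the forgetful functor `φ_{An•} : An•[𝒳] → 𝒳`, an equivalence -/
  φAn : An ⥤ X
  /-- `φ_{An•}` is an equivalence -/
  φAn_isEquivalence : φAn.IsEquivalence
  /-- `η_{An•} : φ_{An•} ∘ π_{An•} ≅ id_𝒳` with `π_{An•} := proj ⋙ κ_{An•}` -/
  ηAn : (proj ⋙ κAn.functor) ⋙ φAn ≅ 𝟭 X
  /-- the second natural equivalence `An•[𝒳] ≃ ℰ•` of "the natural equivalences `ℰ• ≃ An•[𝒳] ≃ ℰ•`" (rows 6 → 7);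
  recorded as an independent datum (the print does not relate it to `κ_{An•}`; interface) -/
  κAn₂ : An ≌ E
  /-- `ℰ⊢ := Th⊢[Z]` -/
  Emono : Type (u + 1)
  /-- category structure -/
  [catEmono : Category.{u} Emono]
  /-- the mono-analyticization `Th•[Z] → Th⊢[Z]` -/
  monoAn : E ⥤ Emono
  /-- `𝒩⊢⊞_w` -/
  NmonoPlus : Vmod → Type (u + 1)
  /-- category structure -/
  [catNmonoPlus : ∀ w, Category.{u} (NmonoPlus w)]
  /-- `𝒩⊢_w` -/
  Nmono : Vmod → Type (u + 1)
  /-- category structure -/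
  [catNmono : ∀ w, Category.{u} (Nmono w)]
  /-- `𝒩⊢⊞_w → 𝒩⊢_w` -/
  forgetMono : ∀ w, NmonoPlus w ⥤ Nmono w
  /-- `𝒩⊢_w → Th⊢[Z]` -/
  toEmono : ∀ w, Nmono w ⥤ Emono
  /-- mono-analyticization `𝒩⊞_v → 𝒩⊢⊞_v` -/
  monoNplus : ∀ v, Nplus v ⥤ NmonoPlus v
  /-- mono-analyticization `𝒩_v → 𝒩⊢_v` -/
  monoN : ∀ v, N v ⥤ Nmono v
  /-- the mono-analyticization homotopy `𝒩⊞_v → 𝒩⊢⊞_v → 𝒩⊢_v ≅ 𝒩⊞_v → 𝒩_v → 𝒩⊢_v` -/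
  monoHomotopy : ∀ v, monoNplus v ⋙ forgetMono v ≅ forget v ⋙ monoN v
  /-- `An⊢[𝒩⊢⊞] := ∏_v An⊢[𝒩⊢⊞_v]` (fibred product over `ℰ⊢`) -/
  AnMono : Type (u + 1)
  /-- category structure -/
  [catAnMono : Category.{u} AnMono]
  /-- the equivalence `Th⊢[Z] ≃ An⊢[𝒩⊢⊞]` of Prop 5.8 (vii) -/
  κAnMono : Emono ≌ AnMono
  /-- the forgetful functors `ψ^{An⊢⊞}_{w,ν} : An⊢[𝒩⊢⊞] → 𝒩⊢⊞_w` (restricted as `φ^{An⊢⊞}_{w,ν}`), "for each vertex `ν`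
  of `Γ⃗^×_w`" (there is no field structure at the space-link / post-log vertices on the mono-analytic side) -/
  ψAnMono : ∀ w, {ν : LogVertex (isArc w) // ν.IsCross} → (AnMono ⥤ NmonoPlus w)

attribute [instance] LogFrobeniusSetting.catX LogFrobeniusSetting.catE LogFrobeniusSetting.catNplus
  LogFrobeniusSetting.catN LogFrobeniusSetting.catAn LogFrobeniusSetting.catEmono
  LogFrobeniusSetting.catNmonoPlus LogFrobeniusSetting.catNmono LogFrobeniusSetting.catAnMono

namespace LogFrobeniusSetting

variable {Vmod : Type u} {isArc : Vmod → Bool} (S : LogFrobeniusSetting Vmod isArc)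

/-- `log•_{T,T}` is an equivalence of categories. [cite: MochizukiAbsTopIII2015, Def 5.4 (ii) p. 125] -/
theorem log_isEquivalence : S.log.IsEquivalence :=
  Functor.isEquivalence_of_iso S.logIsoId.symm

end LogFrobeniusSetting

/-! ## The shape of `D•` and `D•⊢` (Cor 5.5, Cor 5.10) -/

/-- the vertices of the diagram of categories `D•⊢` (rows 1–7 of `D•`, and the mono-analytic rows 3–7 of `D⊢`
glued along the mono-analyticization morphism, Cor 5.10): row 1 = copies of `𝒳` indexed by `L ≅ ℤ`; row 2 = `□`;
rows 3, 4 = `𝒩⊞_v`, `𝒩_v`; rows 5, 6, 7 = `ℰ•, An•[𝒳], ℰ•`; and `𝒩⊢⊞_w, 𝒩⊢_w, ℰ⊢, An⊢[𝒩⊢⊞], ℰ⊢`.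
[cite: MochizukiAbsTopIII2015, Cor 5.5 p. 129] -/
inductive DVertex (Vmod : Type u) (isArc : Vmod → Bool) : Type u
  | row1 (k : ℤ) | core | nplus (v : Vmod) | nv (v : Vmod) | e5 | an | e7
  | nmonoPlus (w : Vmod) | nmono (w : Vmod) | emono5 | anMono | emono7

namespace DVertex

variable {Vmod : Type u} {isArc : Vmod → Bool}

/-- the row index (1–7) of a vertex. [cite: MochizukiAbsTopIII2015, Cor 5.5 p. 130] -/
def row : DVertex Vmod isArc → ℕ
  | row1 _ => 1 | core => 2 | nplus _ => 3 | nv _ => 4 | e5 => 5 | an => 6 | e7 => 7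
  | nmonoPlus _ => 3 | nmono _ => 4 | emono5 => 5 | anMono => 6 | emono7 => 7

/-- the vertices of `D•` proper (as opposed to the glued mono-analytic part `D⊢`).
[cite: MochizukiAbsTopIII2015, Cor 5.10 p. 146] -/
def IsHolomorphic : DVertex Vmod isArc → Prop
  | nmonoPlus _ | nmono _ | emono5 | anMono | emono7 => False
  | _ => True

/-- `D•_{≤n}`: "the subdiagram of categories determined by the first `n` of the seven rows".
[cite: MochizukiAbsTopIII2015, Cor 5.5 p. 130] -/
def InFirstRows (k : ℕ) (x : DVertex Vmod isArc) : Prop := x.IsHolomorphic ∧ x.row ≤ k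

/-- the category realised at a vertex. [cite: MochizukiAbsTopIII2015, Cor 5.5 p. 129] -/
def category (S : LogFrobeniusSetting Vmod isArc) : DVertex Vmod isArc → Type (u + 1)
  | row1 _ => S.X | core => S.X | nplus v => S.Nplus v | nv v => S.N v | e5 => S.E | an => S.An | e7 => S.E
  | nmonoPlus w => S.NmonoPlus w | nmono w => S.Nmono w | emono5 => S.Emono | anMono => S.AnMono | emono7 => S.Emono

/-- each vertex carries a category. [cite: MochizukiAbsTopIII2015, Cor 5.5 p. 129] -/
instance instCategoryVertex (S : LogFrobeniusSetting Vmod isArc) (x : DVertex Vmod isArc) :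
    Category.{u} (x.category S) := by
  cases x <;> dsimp only [category] <;> infer_instance

end DVertex

/-- the arrows of `D•⊢`: `log : 𝒳_{⋎+1} → 𝒳_⋎` (row 1), `id_⋎ : 𝒳_⋎ → □`, `λ⊞_{v,ν} : □ → 𝒩⊞_v` for PRE-LOG `ν`,
`𝒩⊞_v → 𝒩_v → ℰ• → An•[𝒳] → ℰ•`, the mono-analyticization arrows (rows 3–7) `𝒩⊞_v → 𝒩⊢⊞_v`, `𝒩_v → 𝒩⊢_v`, `ℰ• → ℰ⊢` (rows 5 and 7),
`An•[𝒳] → An⊢[𝒩⊢⊞]` ("induced, via the equivalence `κ_{An•}` and the equivalence of Prop 5.8 (vii), by the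
mono-analyticization functor `ℰ• → ℰ⊢`": realised as `κ_{An•}⁻¹ ⋙ (ℰ• → ℰ⊢) ⋙ (ℰ⊢ ≃ An⊢[𝒩⊢⊞])`), and
`𝒩⊢⊞_w → 𝒩⊢_w → ℰ⊢ → An⊢[𝒩⊢⊞] → ℰ⊢`. [cite: MochizukiAbsTopIII2015, Cor 5.5 p. 129] -/
inductive DEdge {Vmod : Type u} (isArc : Vmod → Bool) : DVertex Vmod isArc → DVertex Vmod isArc → Type u
  | log (n : ℤ) : DEdge isArc (.row1 (n + 1)) (.row1 n)
  | toCore (n : ℤ) : DEdge isArc (.row1 n) .core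
  | lam (v : Vmod) (ν : LogVertex (isArc v)) (hν : ν.isPostLog = false) : DEdge isArc .core (.nplus v)
  | forget (v : Vmod) : DEdge isArc (.nplus v) (.nv v)
  | toE (v : Vmod) : DEdge isArc (.nv v) .e5
  | κAn : DEdge isArc .e5 .an
  | anToE : DEdge isArc .an .e7
  | monoNplus (v : Vmod) : DEdge isArc (.nplus v) (.nmonoPlus v)
  | monoN (v : Vmod) : DEdge isArc (.nv v) (.nmono v)
  | monoE5 : DEdge isArc .e5 .emono5
  | monoAn : DEdge isArc .an .anMono
  | monoE7 : DEdge isArc .e7 .emono7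
  | forgetMono (w : Vmod) : DEdge isArc (.nmonoPlus w) (.nmono w)
  | toEmono (w : Vmod) : DEdge isArc (.nmono w) .emono5
  | κAnMono : DEdge isArc .emono5 .anMono
  | anMonoToE : DEdge isArc .anMono .emono7

/-- the functor realised at an arrow of `D•⊢`. [cite: MochizukiAbsTopIII2015, Cor 5.5 p. 129] -/
def DEdge.functor {Vmod : Type u} {isArc : Vmod → Bool} (S : LogFrobeniusSetting Vmod isArc) :
    {a b : DVertex Vmod isArc} → DEdge isArc a b → (a.category S ⥤ b.category S)
  | _, _, log _ => S.log
  | _, _, toCore _ => 𝟭 S.X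
  | _, _, lam v ν _ => S.lam v ν
  | _, _, forget v => S.forget v
  | _, _, toE v => S.toE v
  | _, _, κAn => S.κAn.functor
  | _, _, anToE => S.κAn₂.functor
  | _, _, monoNplus v => S.monoNplus v
  | _, _, monoN v => S.monoN v
  | _, _, monoE5 => S.monoAn
  | _, _, monoAn => S.κAn.inverse ⋙ S.monoAn ⋙ S.κAnMono.functor
  | _, _, monoE7 => S.monoAn
  | _, _, forgetMono w => S.forgetMono w
  | _, _, toEmono w => S.toEmono w
  | _, _, κAnMono => S.κAnMono.functor
  | _, _, anMonoToE => S.κAnMono.inverse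

/-- `Γ⃗_{D•⊢}` as a quiver (so that `D•⊢` is a `DiagramOfCategories` in the sense of Def 3.5 (i), see the follow-up
file on Cor 5.5 / 5.10). [cite: MochizukiAbsTopIII2015, Cor 5.5 p. 129] -/
instance DVertex.instQuiver {Vmod : Type u} {isArc : Vmod → Bool} : Quiver (DVertex Vmod isArc) :=
  ⟨DEdge isArc⟩

/-! ## The combinatorial `ℤ`-action on the first row (underlying Cor 5.5 (v)) -/

/-- the shift `n ↦ n + k` of the first row of `D•`: the underlying combinatorial `ℤ`-action of Cor 5.5 (v) ("the
natural action of `ℤ` on the infinite linear oriented graph `Γ⃗_{D•_{≤1}}`"); the assertion of Cor 5.5 (v) proper —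
extension to `D•` by nexus-classes of self-equivalences compatible with cores and observables — needs the Def 3.5
notions (abc-iut-L4-t2, `DiagramsOfCategories.lean`) and is typed in the follow-up file on the corollaries.
[cite: MochizukiAbsTopIII2015, Cor 5.5 (v) p. 132] -/
def DVertex.shift {Vmod : Type u} {isArc : Vmod → Bool} (k : ℤ) : DVertex Vmod isArc → DVertex Vmod isArc
  | .row1 m => .row1 (m + k)
  | x => x

/-- the shift is an action of `ℤ` on the vertices fixing rows 2–7. [cite: MochizukiAbsTopIII2015, Cor 5.5 (v) p. 132] -/
theorem DVertex.shift_add {Vmod : Type u} {isArc : Vmod → Bool} (k l : ℤ) (x : DVertex Vmod isArc) :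
    x.shift (k + l) = (x.shift k).shift l := by
  cases x <;> simp [DVertex.shift, Int.add_assoc]

/-- the shift by `0` is the identity. [cite: MochizukiAbsTopIII2015, Cor 5.5 (v) p. 132] -/
theorem DVertex.shift_zero {Vmod : Type u} {isArc : Vmod → Bool} (x : DVertex Vmod isArc) : x.shift 0 = x := by
  cases x <;> simp [DVertex.shift]

end Literature.AnabelianGeometry.AbsoluteAnabelian
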